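import Literature.MathematicalPhysics.QuantumManyBody.BoseGasThermodynamicLimitRuelle
import HarnessLib

/-!
# Route `BECTangentRigidity`, crux `RigidMomentumBound` (stmt-AtomisticToContinuum-13034):
# stub `stub_dirichletEnergyLinear` — the Dirichlet ground-state energy is `O(N)` at low density

ONE-BODY INPUT of the registered line for `RigidMomentumBound`: for every repulsive finite-range
pair potential `v` (hard cores allowed) there is `ρ₀ > 0` such that for every `0 < ρ < ρ₀` there
is `C ≥ 0` with `E₀^D(N, (N/ρ)^{1/3}) ≤ C · N` for all large `N`.

Proof: pick a range `R > 0` of `v` (`IsRepulsiveFiniteRange.exists_pos_range`) and put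
`ρ₀ := ((1 + R)³)⁻¹`. For `0 < ρ < ρ₀` one particle per unit cell fits, `ρ (1 + R)³ < 1`, so
Ruelle's finiteness theorem `limsup_lt_top_of_small` (Ruelle 1969 §3.5.11 (F)) gives
`e⁺(ρ) = limsup_N E₀^D(N, L_N)/N < ⊤`; hence eventually `E₀^D(N, L_N)/N < e⁺(ρ) + 1`
(`Filter.eventually_lt_of_limsup_lt`), i.e. `E₀^D(N, L_N) ≤ C N` for `N ≥ 1` with
`C := (e⁺(ρ) + 1).toReal ≥ 0`. (Same argument as the tree's
`Theorems/BECCellInformationEnergyPerParticleBound.lean`, with the extra conjunct `0 ≤ C`.)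

References: D. Ruelle, *Statistical Mechanics: Rigorous Results* (1969), §3.5.11; LSSY 2005,
Thm. 2.2 (2.14) for the sharp constant `4πρa(1 + C Y^{1/3})` (not used).
-/

noncomputable section

namespace Summit.AtomisticToContinuum.BoseEinsteinCondensation.Theorems.RigidMomentumBound

open MeasureTheory Filter
open scoped ENNReal NNReal
open Literature.MathematicalPhysics.QuantumManyBody.BoseGas

/-- **S1 `stub_dirichletEnergyLinear`: the Dirichlet ground-state energy is linear in `N` at low
density.** For every repulsive finite-range `v` there is `ρ₀ > 0` with
`∀ ρ ∈ (0, ρ₀), ∃ C ≥ 0, ∀ᶠ N, groundStateEnergy v N (sideLength ρ N) ≤ ENNReal.ofReal (C * N)`.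
From Ruelle's finiteness of the upper energy per particle below close packing
(`limsup_lt_top_of_small`, Ruelle 1969 §3.5.11 (F)) with `ρ₀ := ((1 + R)³)⁻¹` for a range
`R > 0` of `v` and `C := (e⁺(ρ) + 1).toReal`. [folklore] -/
theorem stub_dirichletEnergyLinear :
    ∀ v : ℝ → ℝ≥0∞, IsRepulsiveFiniteRange v → ∃ ρ₀ : ℝ, 0 < ρ₀ ∧ ∀ ρ : ℝ, 0 < ρ → ρ < ρ₀ →
      ∃ C : ℝ, 0 ≤ C ∧ ∀ᶠ N : ℕ in atTop,
        groundStateEnergy v N (sideLength ρ N) ≤ ENNReal.ofReal (C * N) := by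
  -- adapted from Theorems/BECCellInformationEnergyPerParticleBound.lean (`energyPerParticleBound_proof`)
  intro v hv
  obtain ⟨R, hR, hv0⟩ := hv.exists_pos_range
  have h3 : 0 < (1 + R) ^ 3 := by positivity
  refine ⟨((1 + R) ^ 3)⁻¹, inv_pos.2 h3, fun ρ hρ hρlt => ?_⟩
  have hsmall : ρ * (1 + R) ^ 3 < 1 := by
    have := mul_lt_mul_of_pos_right hρlt h3
    rwa [inv_mul_cancel₀ h3.ne'] at this
  have hfin : limsupEnergyPerParticle v ρ < ⊤ := limsup_lt_top_of_small hv.1 hv0 hR hρ hsmall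
  set e := limsupEnergyPerParticle v ρ with he
  have he1 : e + 1 ≠ ⊤ := ENNReal.add_ne_top.2 ⟨hfin.ne, ENNReal.one_ne_top⟩
  refine ⟨(e + 1).toReal, ENNReal.toReal_nonneg, ?_⟩
  have hlt : limsup (energyPerParticleDirichlet v ρ) atTop < e + 1 :=
    ENNReal.lt_add_right hfin.ne one_ne_zero
  filter_upwards [Filter.eventually_lt_of_limsup_lt hlt, eventually_gt_atTop 0] with N hN hN0
  have hN0' : (N : ℝ≥0∞) ≠ 0 := Nat.cast_ne_zero.2 (Nat.pos_iff_ne_zero.1 hN0)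
  have hNtop : (N : ℝ≥0∞) ≠ ⊤ := ENNReal.natCast_ne_top N
  have hN' : groundStateEnergy v N (sideLength ρ N) < (e + 1) * N := by
    rw [← ENNReal.div_lt_iff (Or.inl hN0') (Or.inl hNtop)]
    exact hN
  rw [ENNReal.ofReal_mul ENNReal.toReal_nonneg, ENNReal.ofReal_toReal he1, ENNReal.ofReal_natCast]
  exact hN'.le

end Summit.AtomisticToContinuum.BoseEinsteinCondensation.Theorems.RigidMomentumBound

end
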